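import Summits.CriticalPhenomena.Ising3DConformalLimit.Theorems.StrandShadow.Negative.ClusterDecomposition
import Summits.CriticalPhenomena.Ising3DConformalLimit.Theorems.StrandShadow.Negative.PairSplitDeletion
import Literature.Probability.LatticeModels.LoopO1
import Literature.Probability.LatticeModels.ModifiedSimonInequality
import Summits.CriticalPhenomena.Ising3DConformalLimit.Theorems.FKParityRobustnessStrandShadowOddCutDefs
import HarnessLib

/-!
# Stub `stub_bridgesJoin` of line `odd-cluster-cut-exact-helper` (crux `StrandShadow`, stmt-CriticalPhenomena-14626)

Finite graph `G`, `β ≥ 0`, `t = tanh β`, four marked vertices `a : Fin 4 → V`.  The joined mass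
`JJ = Σ_{F ∈ 𝒯_A} g(F)`, `g(F) = Σ_{F′ ∈ 𝒯_∅} Σ_{η ⊆ E} 1[a₀,…,a₃ joined in F ∪ F′ ∪ η] t^|F| t^|F′| w(η)`
(`w(η) = (t²)^|η| (1 − t²)^{|E|−|η|}`, `g ≥ 0`), is bounded below by restricting the outer sum to
the disjoint union of

* the all-joined set `{F : a₀ ↝_F a₁, a₂, a₃}`, on which the indicator is identically `1`
  (monotonicity of reachability), `Σ_{F′} t^|F′| = Z^∅` and `Σ_η w(η) = (t² + 1 − t²)^|E| = 1`,
  so that its contribution is `AJ · Z^∅` (`bridgesJoin_allJoined_eq`);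
* the fibres `{F : (K_{a₀}F, K_{a₂}F) = (K, K′)}` over the pairing cluster pairs `(K, K′) ∈ pairIdx`
  (pairwise disjoint, and disjoint from the all-joined set since `a₀`-reachability inside `F` is
  that inside `K`, `rch_clusterEdges_iff`), on which one helper bridge
  `a₀ ↝_K k ∼_η u ↝_{medium} v ∼_η k′ ↝_{K′} a₂` joins `a₀` to `a₂` inside `F ∪ F′ ∪ η`, while
  `a₀ ↝_F a₁` and `a₂ ↝_F a₃` by the handshake `rch_a1`; hence `BB(K,K′) ≤ Σ_{F ∈ fibre} g(F)`
  (`bridgesJoin_bridged_le`).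

Assembled in `stub_bridgesJoin`: `AJ · Z^∅ + Σ_{(K,K′)} BB(K,K′) ≤ JJ`.
-/

noncomputable section

open Finset SimpleGraph
open scoped ENNReal symmDiff
open Literature.Probability.LatticeModels
open Summit.CriticalPhenomena.Ising3DConformalLimit.StrandShadowNegative (Rch clusterEdges)


namespace Summit.CriticalPhenomena.Ising3DConformalLimit.Theorems.StrandShadowOddCut

open scoped Classical
open Summit.CriticalPhenomena.Ising3DConformalLimit.StrandShadowNegative

section BridgesJoinHelpers

variable {V : Type*} [Fintype V] [DecidableEq V] (G : SimpleGraph V) [DecidableRel G.Adj]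

omit [DecidableEq V] in
/-- `Σ_{η ⊆ E(G)} w(η) = (t² + (1 − t²))^{|E(G)|} = 1`. -/
private theorem bridgesJoin_sum_etaWeight (t : ℝ) :
    ∑ η ∈ G.edgeFinset.powerset, etaWeight G t η = 1 := by
  have h1 : t ^ 2 + (1 - t ^ 2) = 1 := by ring
  unfold etaWeight
  rw [Finset.sum_pow_mul_eq_add_pow, h1, one_pow]

omit [DecidableEq V] in
/-- The configuration weight `t^{|F|} t^{|F′|} w(η)` is nonnegative for `β ≥ 0`
(`0 ≤ tanh β`, `tanh² β < 1`). -/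
private theorem bridgesJoin_w_nonneg {β : ℝ} (hβ : 0 ≤ β) (F F' η : Finset (Sym2 V)) :
    0 ≤ Real.tanh β ^ F.card * Real.tanh β ^ F'.card * etaWeight G (Real.tanh β) η := by
  have ht : 0 ≤ Real.tanh β := by
    rw [Real.tanh_eq_sinh_div_cosh]
    exact div_nonneg (Real.sinh_nonneg_iff.2 hβ) (Real.cosh_pos _).le
  have h1 : 0 ≤ 1 - Real.tanh β ^ 2 := sub_nonneg.2 (Real.tanh_sq_lt_one β).le
  unfold etaWeight
  exact mul_nonneg (mul_nonneg (pow_nonneg ht _) (pow_nonneg ht _))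
    (mul_nonneg (pow_nonneg (sq_nonneg _) _) (pow_nonneg h1 _))

/-- Handshake in a pairing `A`-join: if the `a₀`-cluster of `F ∈ 𝒯_A` avoids `a₂, a₃`, then
`a₀ ↝_F a₁` and `a₂ ↝_F a₃`. -/
private theorem bridgesJoin_pairing_rch (a : Fin 4 → V) {F : Finset (Sym2 V)}
    (hF : F ∈ tJoins G Set.univ (Finset.univ.image a)) (h2 : ¬ Rch F (a 0) (a 2))
    (h3 : ¬ Rch F (a 0) (a 3)) : Rch F (a 0) (a 1) ∧ Rch F (a 2) (a 3) := by
  have hmem : ∀ i, a i ∈ (Finset.univ.image a : Finset V) := fun i =>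
    Finset.mem_image_of_mem a (Finset.mem_univ i)
  have h01 : Rch F (a 0) (a 1) := by
    refine rch_a1 G (hmem 0) (fun v hv hr => ?_) hF
    obtain ⟨i, -, rfl⟩ := Finset.mem_image.1 hv
    fin_cases i
    · exact Or.inl rfl
    · exact Or.inr rfl
    · exact absurd hr h2
    · exact absurd hr h3
  refine ⟨h01, rch_a1 G (hmem 2) (fun v hv hr => ?_) hF⟩
  obtain ⟨i, -, rfl⟩ := Finset.mem_image.1 hv
  fin_cases i
  · exact absurd (SimpleGraph.Reachable.symm hr) h2
  · exact absurd (SimpleGraph.Reachable.trans h01 (SimpleGraph.Reachable.symm hr)) h2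
  · exact Or.inl rfl
  · exact Or.inr rfl

/-- A member of the fibre of a pairing cluster pair is itself a pairing `A`-join
(`a₀`-reachability inside `F` is `a₀`-reachability inside `K_{a₀}F`). -/
private theorem bridgesJoin_fibre_pairing (a : Fin 4 → V)
    {KK : Finset (Sym2 V) × Finset (Sym2 V)} (hKK : KK ∈ pairIdx G a) {F : Finset (Sym2 V)}
    (hF : F ∈ fibre G a KK) :
    F ∈ tJoins G Set.univ (Finset.univ.image a) ∧ ¬ Rch F (a 0) (a 2) ∧ ¬ Rch F (a 0) (a 3) := by
  rw [fibre, Finset.mem_filter] at hF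
  obtain ⟨hFT, hK1, -⟩ := hF
  rw [pairIdx, Finset.mem_image] at hKK
  obtain ⟨F₀, hF₀, hKK⟩ := hKK
  rw [pairingSet, Finset.mem_filter] at hF₀
  obtain ⟨-, h02, h03⟩ := hF₀
  have hK : clusterEdges F (a 0) = clusterEdges F₀ (a 0) := by rw [hK1, ← hKK]
  have hiff : ∀ v, Rch F (a 0) v ↔ Rch F₀ (a 0) v := fun v => by
    rw [← rch_clusterEdges_iff F, hK, rch_clusterEdges_iff]
  exact ⟨hFT, fun h => h02 ((hiff _).1 h), fun h => h03 ((hiff _).1 h)⟩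

/-- On the fibre of a pairing cluster pair `(K, K′)`, one helper bridge
`a₀ ↝_K k ∼_η u ↝_{medium} v ∼_η k′ ↝_{K′} a₂` joins all four marked vertices in `F ∪ F′ ∪ η`. -/
private theorem bridgesJoin_joined (a : Fin 4 → V) {KK : Finset (Sym2 V) × Finset (Sym2 V)}
    (hKK : KK ∈ pairIdx G a) {F : Finset (Sym2 V)} (hF : F ∈ fibre G a KK)
    {F' η : Finset (Sym2 V)} (hb : 1 ≤ bridges G a KK F F' η) :
    ∀ i j : Fin 4, Rch (F ∪ F' ∪ η) (a i) (a j) := by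
  obtain ⟨hFT, h2, h3⟩ := bridgesJoin_fibre_pairing G a hKK hF
  obtain ⟨h01, h23⟩ := bridgesJoin_pairing_rch G a hFT h2 h3
  rw [fibre, Finset.mem_filter] at hF
  obtain ⟨-, hK1, hK2⟩ := hF
  rw [bridges] at hb
  obtain ⟨p, hp⟩ := Finset.one_le_card.1 hb
  rw [Finset.mem_filter] at hp
  obtain ⟨hpA, hη1, hη2, hmed⟩ := hp
  rw [attachPairs, Finset.mem_filter] at hpA
  obtain ⟨-, hk, -, -, hk', -, -, -⟩ := hpA
  set U := F ∪ F' ∪ η with hU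
  have hFU : F ⊆ U := Finset.subset_union_left.trans Finset.subset_union_left
  have hηU : η ⊆ U := Finset.subset_union_right
  have hmedU : medium a KK U ⊆ U := Finset.filter_subset _ _
  have hK1U : KK.1 ⊆ U := by rw [← hK1]; exact (clusterEdges_subset F (a 0)).trans hFU
  have hK2U : KK.2 ⊆ U := by rw [← hK2]; exact (clusterEdges_subset F (a 2)).trans hFU
  have h0k : Rch U (a 0) p.1.1 := rch_mono hK1U hk
  have h0u : Rch U (a 0) p.1.2 :=
    rch_step (hηU hη1) (Sym2.mem_mk_left _ _) (Sym2.mem_mk_right _ _) h0k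
  have h0v : Rch U (a 0) p.2.2 := SimpleGraph.Reachable.trans h0u (rch_mono hmedU hmed)
  have h0k' : Rch U (a 0) p.2.1 :=
    rch_step (hηU hη2) (Sym2.mem_mk_right _ _) (Sym2.mem_mk_left _ _) h0v
  have h02 : Rch U (a 0) (a 2) :=
    SimpleGraph.Reachable.trans h0k' (SimpleGraph.Reachable.symm (rch_mono hK2U hk'))
  have hall : ∀ i : Fin 4, Rch U (a 0) (a i) := by
    intro i
    fin_cases i
    · exact rch_refl U (a 0)
    · exact rch_mono hFU h01
    · exact h02
    · exact SimpleGraph.Reachable.trans h02 (rch_mono hFU h23)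
  exact fun i j => SimpleGraph.Reachable.trans (SimpleGraph.Reachable.symm (hall i)) (hall j)

/-- `AJ · Z^∅ = Σ_{F all-joined} g(F)`: on the all-joined set the indicator is `1`, and
`Σ_{F′} t^|F′| = Z^∅`, `Σ_η w(η) = 1`. -/
private theorem bridgesJoin_allJoined_eq (β : ℝ) (a : Fin 4 → V) :
    allJoinedMass G β a * loopO1PartitionFunction G (Real.tanh β) ∅ =
      ∑ F ∈ (tJoins G Set.univ (Finset.univ.image a)).filter (fun F : Finset (Sym2 V) =>
          Rch F (a 0) (a 1) ∧ Rch F (a 0) (a 2) ∧ Rch F (a 0) (a 3)),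
        ∑ F' ∈ tJoins G Set.univ (∅ : Finset V), ∑ η ∈ G.edgeFinset.powerset,
          if (∀ i j : Fin 4, Rch (F ∪ F' ∪ η) (a i) (a j)) then
            Real.tanh β ^ F.card * Real.tanh β ^ F'.card * etaWeight G (Real.tanh β) η
          else 0 := by
  rw [allJoinedMass, loopO1PartitionFunction_eq_sum_tJoins, Finset.sum_mul]
  refine Finset.sum_congr rfl fun F hF => ?_
  rw [Finset.mul_sum]
  refine Finset.sum_congr rfl fun F' _ => ?_
  obtain ⟨-, h1, h2, h3⟩ := Finset.mem_filter.1 hF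
  have hall : ∀ η : Finset (Sym2 V), ∀ i j : Fin 4, Rch (F ∪ F' ∪ η) (a i) (a j) := by
    intro η
    have hsub : F ⊆ F ∪ F' ∪ η := Finset.subset_union_left.trans Finset.subset_union_left
    have h0 : ∀ i : Fin 4, Rch (F ∪ F' ∪ η) (a 0) (a i) := by
      intro i
      fin_cases i
      · exact rch_refl _ _
      · exact rch_mono hsub h1
      · exact rch_mono hsub h2
      · exact rch_mono hsub h3
    exact fun i j => SimpleGraph.Reachable.trans (SimpleGraph.Reachable.symm (h0 i)) (h0 j)
  have hin : (∑ η ∈ G.edgeFinset.powerset,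
      if (∀ i j : Fin 4, Rch (F ∪ F' ∪ η) (a i) (a j)) then
        Real.tanh β ^ F.card * Real.tanh β ^ F'.card * etaWeight G (Real.tanh β) η else 0) =
      ∑ η ∈ G.edgeFinset.powerset,
        Real.tanh β ^ F.card * Real.tanh β ^ F'.card * etaWeight G (Real.tanh β) η :=
    Finset.sum_congr rfl fun η _ => if_pos (hall η)
  rw [hin, ← Finset.mul_sum, bridgesJoin_sum_etaWeight, mul_one]

/-- `BB(K,K′) ≤ Σ_{F ∈ fibre(K,K′)} g(F)`: termwise, a helper bridge joins all four marked
vertices and the weights are nonnegative. -/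
private theorem bridgesJoin_bridged_le {β : ℝ} (hβ : 0 ≤ β) (a : Fin 4 → V)
    {KK : Finset (Sym2 V) × Finset (Sym2 V)} (hKK : KK ∈ pairIdx G a) :
    bridgedMass G β a KK ≤ ∑ F ∈ fibre G a KK, ∑ F' ∈ tJoins G Set.univ (∅ : Finset V),
        ∑ η ∈ G.edgeFinset.powerset,
          if (∀ i j : Fin 4, Rch (F ∪ F' ∪ η) (a i) (a j)) then
            Real.tanh β ^ F.card * Real.tanh β ^ F'.card * etaWeight G (Real.tanh β) η
          else 0 := by
  rw [bridgedMass, cfg, Finset.sum_product]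
  refine Finset.sum_le_sum fun F hF => ?_
  rw [Finset.sum_product]
  refine Finset.sum_le_sum fun F' _ => Finset.sum_le_sum fun η _ => ?_
  split_ifs with hb hj
  · exact le_of_eq rfl
  · exact absurd (bridgesJoin_joined G a hKK hF hb) hj
  · exact bridgesJoin_w_nonneg G hβ F F' η
  · exact le_rfl

/-- Disjoint-union bound: the all-joined set and the fibres over `pairIdx` are pairwise disjoint
subsets of `𝒯_A`, so for `g ≥ 0` their `g`-masses add up to at most `Σ_{F ∈ 𝒯_A} g(F)`. -/
private theorem bridgesJoin_union_le (a : Fin 4 → V) {g : Finset (Sym2 V) → ℝ}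
    (hg : ∀ F, 0 ≤ g F) :
    (∑ F ∈ (tJoins G Set.univ (Finset.univ.image a)).filter (fun F : Finset (Sym2 V) =>
        Rch F (a 0) (a 1) ∧ Rch F (a 0) (a 2) ∧ Rch F (a 0) (a 3)), g F) +
      ∑ KK ∈ pairIdx G a, ∑ F ∈ fibre G a KK, g F ≤
      ∑ F ∈ tJoins G Set.univ (Finset.univ.image a), g F := by
  have hdisjS : ((pairIdx G a : Set (Finset (Sym2 V) × Finset (Sym2 V)))).PairwiseDisjoint
      (fibre G a) := by
    intro KK _ KK' _ hne
    show Disjoint (fibre G a KK) (fibre G a KK')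
    rw [Finset.disjoint_left]
    intro F hF hF'
    rw [fibre, Finset.mem_filter] at hF hF'
    exact hne (Prod.ext (hF.2.1.symm.trans hF'.2.1) (hF.2.2.symm.trans hF'.2.2))
  rw [← Finset.sum_biUnion hdisjS]
  have hdisj : Disjoint ((tJoins G Set.univ (Finset.univ.image a)).filter
      (fun F : Finset (Sym2 V) => Rch F (a 0) (a 1) ∧ Rch F (a 0) (a 2) ∧ Rch F (a 0) (a 3)))
      ((pairIdx G a).biUnion (fibre G a)) := by
    rw [Finset.disjoint_left]
    intro F hFA hFS
    obtain ⟨KK, hKK, hF⟩ := Finset.mem_biUnion.1 hFS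
    exact (bridgesJoin_fibre_pairing G a hKK hF).2.1 (Finset.mem_filter.1 hFA).2.2.1
  rw [← Finset.sum_union hdisj]
  refine Finset.sum_le_sum_of_subset_of_nonneg (Finset.union_subset (Finset.filter_subset _ _)
    (Finset.biUnion_subset.2 fun KK _ => ?_)) fun F _ _ => hg F
  rw [fibre]
  exact Finset.filter_subset _ _

end BridgesJoinHelpers

/-- **stub_bridgesJoin** (finite graph; M). On the fibre of `(K,K′)` a helper bridge
`k ~ u ↔_H v ~ k′` with both attaching bonds in `η` joins `K ∋ a₀,a₁` to `K′ ∋ a₂,a₃` inside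
`F ∪ F′ ∪ η` (`a₁ ∈ V(K)`, `a₃ ∈ V(K′)` by the handshake `rch_a1`); the fibres over distinct
cluster pairs are disjoint subsets of the pairing event, itself disjoint from `{F joins A}` on
which `Σ_η w(η) = 1`: `AJ·Z∅ + Σ_{(K,K′)} BB(K,K′) ≤ JJ`. -/
theorem stub_bridgesJoin :
    ∀ (V : Type) [Fintype V] [DecidableEq V] (G : SimpleGraph V) [DecidableRel G.Adj] (β : ℝ),
      0 ≤ β → ∀ a : Fin 4 → V, Function.Injective a →
      allJoinedMass G β a * loopO1PartitionFunction G (Real.tanh β) ∅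
          + ∑ KK ∈ pairIdx G a, bridgedMass G β a KK ≤ jointJoinMass G β a := by
  intro V _ _ G _ β hβ a _
  have hB : ∑ KK ∈ pairIdx G a, bridgedMass G β a KK ≤
      ∑ KK ∈ pairIdx G a, ∑ F ∈ fibre G a KK, ∑ F' ∈ tJoins G Set.univ (∅ : Finset V),
        ∑ η ∈ G.edgeFinset.powerset,
          if (∀ i j : Fin 4, Rch (F ∪ F' ∪ η) (a i) (a j)) then
            Real.tanh β ^ F.card * Real.tanh β ^ F'.card * etaWeight G (Real.tanh β) η
          else 0 :=
    Finset.sum_le_sum fun KK hKK => bridgesJoin_bridged_le G hβ a hKK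
  have hC := bridgesJoin_union_le G a (g := fun F : Finset (Sym2 V) =>
      ∑ F' ∈ tJoins G Set.univ (∅ : Finset V), ∑ η ∈ G.edgeFinset.powerset,
        if (∀ i j : Fin 4, Rch (F ∪ F' ∪ η) (a i) (a j)) then
          Real.tanh β ^ F.card * Real.tanh β ^ F'.card * etaWeight G (Real.tanh β) η
        else 0)
    (fun F => Finset.sum_nonneg fun F' _ => Finset.sum_nonneg fun η _ => by
      split_ifs
      · exact bridgesJoin_w_nonneg G hβ F F' η
      · exact le_rfl)
  rw [bridgesJoin_allJoined_eq, jointJoinMass]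
  linarith

end Summit.CriticalPhenomena.Ising3DConformalLimit.Theorems.StrandShadowOddCut

end
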